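import Literature.MathematicalPhysics.QuantumLattice.HubbardHalfFilledPseudospinSinglet
import Literature.MathematicalPhysics.QuantumLattice.HubbardModelParticleHoleProofs
import Literature.MathematicalPhysics.QuantumLattice.SpinTwistedHubbardTorus
import HarnessLib

/-!
# The one-body density matrix of the half-filled Hubbard ground state (Lieb–Loss–McCann)

Lieb, Loss and McCann, *Uniform density theorem for the Hubbard model*, J. Math. Phys. **34** (1993)
891 (arXiv:cond-mat/9304015), Theorem, eqs. (5)–(6): for the Hubbard model with real bipartite
hopping at half filling the one-body density matrix `ρ_σ(x,y) = ⟨c†_{xσ} c_{yσ}⟩` satisfies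
`ρ_σ(x,x) = 1/2` and `ρ_σ(x,y) = 0` whenever `x ≠ y` lie on the *same* sublattice — for the
canonical and grand-canonical Gibbs states at every `β` and for their `β → ∞` limits, and for
every interaction strength. This file proves the ground-state case (`β → ∞`, canonical) for the
standard Hubbard Hamiltonian `hamiltonian G t U` on a connected bipartite graph `G` with colour
classes of equal size, `t ≠ 0`, `U > 0`, where by Lieb's theorem
(`LiebHalfFilled.finrank_groundSector_eq_one`) the half-filled ground state `ψ` is unique, so that
the `β → ∞` canonical state *is* the ground-state expectation `⟨ψ, · ψ⟩/‖ψ‖²`.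

The proof is Lieb–Loss–McCann's (`Y = J W`, complex conjugation times MacLachlan's hole–particle
map), run on the ground-state vector:

* **(J) reality.** The Jordan–Wigner matrices are real (`annihilation_transpose : (c_i)ᵀ = c†_i`, from
  `SpinTwistedHubbardTorus`),
  hence so is `H` (`conjTranspose_hamiltonian_eq_transpose : Hᴴ = Hᵀ`); complex conjugation
  `ψ ↦ star ψ` therefore preserves the half-filled ground sector and uniqueness forces
  `star ψ = c ψ` (`exists_star_eq_smul_of_groundState`); consequently every real observable `X`
  (`Xᴴ = Xᵀ`) has a real ground-state expectation (`star_expect_eq_of_groundState`).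
* **(W) hole–particle symmetry.** With the full particle–hole transformation `P`
  (`c_{xσ} ↦ ε_x c†_{xσ}`, `Fock.particleHole`) one has `P H Pᴴ = H - U N̂ + U|Λ|`
  (`hamiltonian_particleHole_bipartite_holds`), so `Pᴴ ψ` is again a half-filled ground state and
  `Pᴴ ψ = c' ψ` (`exists_particleHole_conjTranspose_mulVec_eq_smul`); hence `⟨P X Pᴴ⟩ = ⟨X⟩`
  (`expect_particleHole_conj_eq_of_groundState`) and, since `P c†_a c_b Pᴴ = ε_a ε_b c_a c†_b`,
  `ρ(a,b) = ε_a ε_b (δ_{ab} ‖ψ‖² - ρ(b,a))` for all orbitals `a, b`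
  (`expect_creation_mul_annihilation_particleHole`).
* Hermiticity `ρ(b,a) = conj ρ(a,b)` and reality give: `ρ` is real symmetric
  (`star_expect_creation_mul_annihilation_of_groundState`,
  `expect_creation_mul_annihilation_comm_of_groundState`), `ρ(a,a) = ‖ψ‖²/2` (eq. (5),
  `expect_numberAt_eq_half_of_groundState'`; another proof is in `HubbardPseudospinIsotropy`), and
  **`ρ(a,b) = 0` for distinct orbitals `a ≠ b` on the same sublattice** (eq. (6), any two spins;
  `expect_creation_mul_annihilation_eq_zero_of_groundState`).

Also recorded: the kinetic-energy functional `⟨φ, H(t,0) φ⟩ = -t Σ_σ Σ_{x∼y} ⟨φ, c†_{xσ} c_{yσ} φ⟩`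
(`expect_hamiltonian_zero_eq_sum`, any vector), and the even square torus `(ℤ/Lℤ)²`
(`hubbardTorus_…`): `ρ_σ(x, x+r) = 0` for every `r ≠ 0` of even parity `ε_r = +1`, and the
"even part" sum rule `Σ_r f(r) (1 + ε_r) Σ_x ρ_σ(x,x+r) = L² f(0) ‖ψ‖²` for every test function `f`
(with `f(r) = e^{-ik·r}/L²`: the momentum distribution obeys `n_σ(k) + n_σ(k+(π,π)) = 1`).

References: E.H. Lieb, M. Loss, R.J. McCann, J. Math. Phys. 34 (1993) 891 [LiebLossMccann1993];
E.H. Lieb, PRL 62 (1989) 1201 [LiebPRL1989]; H. Tasaki, *Physics and Mathematics of Quantum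
Many-Body Systems* (2020) §9.3.3 [Tasaki2020]; A.D. MacLachlan, Mol. Phys. 2 (1959) 271 (the
hole–particle map, as cited by LLM).
-/

noncomputable section

namespace Literature.MathematicalPhysics.QuantumLattice

open Matrix Finset Fock
open scoped ComplexOrder

/-! ### §1 Real matrices: the Jordan–Wigner operators and the Hubbard Hamiltonian -/

section Real

variable {ι : Type*} [LinearOrder ι] [Fintype ι]

omit [Fintype ι] in
/-- Realness of `c_i` in the form `ᴴ = ᵀ`. [cite: LiebLossMccann1993, proof of Theorem (real case)] -/
theorem conjTranspose_annihilation_eq_transpose (i : ι) :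
    (annihilation i)ᴴ = (annihilation i)ᵀ := by
  rw [annihilation_conjTranspose, annihilation_transpose]

omit [Fintype ι] in
/-- Realness of `c†_i` in the form `ᴴ = ᵀ`. [cite: LiebLossMccann1993, proof of Theorem (real case)] -/
theorem conjTranspose_creation_eq_transpose (i : ι) : (creation i)ᴴ = (creation i)ᵀ := by
  rw [creation_conjTranspose, creation_transpose]

/-- Products of real matrices are real (`ᴴ = ᵀ` form). [folklore] -/
private theorem conjTranspose_mul_eq_transpose {m : Type*} [Fintype m] {A B : Matrix m m ℂ}
    (hA : Aᴴ = Aᵀ) (hB : Bᴴ = Bᵀ) : (A * B)ᴴ = (A * B)ᵀ := by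
  rw [conjTranspose_mul, transpose_mul, hA, hB]

/-- A real matrix commutes with complex conjugation of vectors: `conj (M v) = M (conj v)`.
[folklore] -/
private theorem star_mulVec_of_conjTranspose_eq_transpose {m : Type*} [Fintype m]
    {M : Matrix m m ℂ} (hM : Mᴴ = Mᵀ) (v : m → ℂ) : star (M *ᵥ v) = M *ᵥ star v := by
  rw [star_mulVec, hM, vecMul_transpose]

omit [LinearOrder ι] in
/-- `⟨ψ, Xᴴ ψ⟩ = conj ⟨ψ, X ψ⟩`. [folklore] -/
private theorem expect_conjTranspose₁ (X : Matrix (Finset ι) (Finset ι) ℂ) (ψ : Fock ι) :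
    expect Xᴴ ψ = star (expect X ψ) := by
  unfold expect
  rw [star_dotProduct ψ (Xᴴ *ᵥ ψ), star_mulVec, conjTranspose_conjTranspose, ← dotProduct_mulVec]

omit [LinearOrder ι] in
/-- `⟨ψ, (c X) ψ⟩ = c ⟨ψ, X ψ⟩`. [folklore] -/
private theorem expect_smul₁ (c : ℂ) (X : Matrix (Finset ι) (Finset ι) ℂ) (ψ : Fock ι) :
    expect (c • X) ψ = c * expect X ψ := by
  simp [expect, smul_mulVec, dotProduct_smul]

omit [LinearOrder ι] in
/-- `⟨ψ, (X - Y) ψ⟩ = ⟨ψ, X ψ⟩ - ⟨ψ, Y ψ⟩`. [folklore] -/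
private theorem expect_sub₁ (X Y : Matrix (Finset ι) (Finset ι) ℂ) (ψ : Fock ι) :
    expect (X - Y) ψ = expect X ψ - expect Y ψ := by
  simp [expect, sub_mulVec, dotProduct_sub]

omit [LinearOrder ι] in
/-- `⟨ψ, (Σ_i X_i) ψ⟩ = Σ_i ⟨ψ, X_i ψ⟩`. [folklore] -/
private theorem expect_sum₁ {α : Type*} (s : Finset α) (X : α → Matrix (Finset ι) (Finset ι) ℂ)
    (ψ : Fock ι) : expect (∑ i ∈ s, X i) ψ = ∑ i ∈ s, expect (X i) ψ := by
  simp [expect, Matrix.sum_mulVec, dotProduct_sum]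

/-- `⟨ψ, 1 ψ⟩ = ‖ψ‖²`, `⟨ψ, 0 ψ⟩ = 0`, and `expect` of an `if`. [folklore] -/
private theorem expect_ite_one_zero (p : Prop) [Decidable p] (ψ : Fock ι) :
    expect (if p then (1 : Matrix (Finset ι) (Finset ι) ℂ) else 0) ψ =
      if p then star ψ ⬝ᵥ ψ else 0 := by
  split_ifs <;> simp [expect]

omit [LinearOrder ι] in
/-- `expect` of an `if … else 0`. [folklore] -/
private theorem expect_ite_zero (p : Prop) [Decidable p] (X : Matrix (Finset ι) (Finset ι) ℂ)
    (ψ : Fock ι) : expect (if p then X else 0) ψ = if p then expect X ψ else 0 := by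
  split_ifs <;> simp [expect]

/-- `ε ε = 1` in `ℂ` for a sign `ε ∈ ℤˣ`. [folklore] -/
private theorem intCast_units_mul_self (u : ℤˣ) : ((u : ℤ) : ℂ) * ((u : ℤ) : ℂ) = 1 := by
  rcases Int.units_eq_one_or u with h | h <;> simp [h]

end Real

section Graph

variable {Λ : Type*} [LinearOrder Λ] [Fintype Λ] (G : SimpleGraph Λ) [DecidableRel G.Adj]

/-- **The Hubbard Hamiltonian with real hopping is a real matrix** in the occupation-number basis:
`Hᴴ = Hᵀ` (equivalently, since `H` is Hermitian, `H` is real symmetric). Lieb–Loss–McCann (1993),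
proof of the Theorem, real case. [cite: LiebLossMccann1993, proof of Theorem (real case)] -/
theorem conjTranspose_hamiltonian_eq_transpose (t U : ℝ) :
    (hamiltonian G t U)ᴴ = (hamiltonian G t U)ᵀ := by
  have hca : ∀ i : Orb Λ, (annihilation i)ᴴ = (annihilation i)ᵀ :=
    conjTranspose_annihilation_eq_transpose
  have hcc : ∀ i : Orb Λ, (creation i)ᴴ = (creation i)ᵀ := conjTranspose_creation_eq_transpose
  have hhop : ∀ (x y : Λ) (σ : Fin 2),
      (if G.Adj x y then creation (orb x σ) * annihilation (orb y σ)
        else (0 : Matrix (Finset (Orb Λ)) (Finset (Orb Λ)) ℂ))ᴴ =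
        (if G.Adj x y then creation (orb x σ) * annihilation (orb y σ) else 0)ᵀ := by
    intro x y σ
    split_ifs
    · exact conjTranspose_mul_eq_transpose (hcc _) (hca _)
    · rw [conjTranspose_zero, transpose_zero]
  have hn1 : ∀ (x : Λ) (σ : Fin 2), (numberOp x σ)ᴴ = (numberOp x σ)ᵀ := fun x σ => by
    unfold numberOp
    exact conjTranspose_mul_eq_transpose (hcc _) (hca _)
  have hnn : ∀ x : Λ, (numberOp x 0 * numberOp x 1)ᴴ = (numberOp x 0 * numberOp x 1)ᵀ := fun x =>
    conjTranspose_mul_eq_transpose (hn1 x 0) (hn1 x 1)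
  have ht' : star (-(t : ℂ)) = -(t : ℂ) := by rw [star_neg, Complex.star_def, Complex.conj_ofReal]
  have hU' : star (U : ℂ) = (U : ℂ) := by rw [Complex.star_def, Complex.conj_ofReal]
  unfold hamiltonian
  rw [conjTranspose_add, conjTranspose_smul, conjTranspose_smul, transpose_add, transpose_smul,
    transpose_smul, ht', hU']
  simp only [conjTranspose_sum, transpose_sum, hhop, hnn]

/-- Complex conjugation of wave functions commutes with the (real-hopping) Hubbard Hamiltonian:
`conj (H φ) = H (conj φ)`. [cite: LiebLossMccann1993, proof of Theorem (real case)] -/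
theorem star_hamiltonian_mulVec (t U : ℝ) (φ : Fock (Orb Λ)) :
    star (hamiltonian G t U *ᵥ φ) = hamiltonian G t U *ᵥ star φ :=
  star_mulVec_of_conjTranspose_eq_transpose (conjTranspose_hamiltonian_eq_transpose G t U) φ

/-- **The kinetic-energy functional in terms of the one-body density matrix** (any vector `φ`):
`⟨φ, H(t,0) φ⟩ = -t Σ_x Σ_y Σ_σ [x ∼ y] ⟨φ, c†_{xσ} c_{yσ} φ⟩` (ordered adjacent pairs).
Lieb–Loss–McCann (1993), eq. (3) with `U = 0`. [cite: LiebLossMccann1993, eq. (3)] -/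
theorem expect_hamiltonian_zero_eq_sum (t : ℝ) (φ : Fock (Orb Λ)) :
    expect (hamiltonian G t 0) φ =
      -(t : ℂ) * ∑ x : Λ, ∑ y : Λ, ∑ σ : Fin 2,
        if G.Adj x y then expect (creation (orb x σ) * annihilation (orb y σ)) φ else 0 := by
  unfold hamiltonian
  rw [Complex.ofReal_zero, zero_smul, add_zero, expect_smul₁, expect_sum₁]
  congr 1
  refine Finset.sum_congr rfl fun x _ => ?_
  rw [expect_sum₁]
  refine Finset.sum_congr rfl fun y _ => ?_
  rw [expect_sum₁]
  exact Finset.sum_congr rfl fun σ _ => expect_ite_zero _ _ _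

variable {G}

/-! ### §2 (J) Reality of the unique half-filled ground state -/

/-- **Complex conjugation fixes the half-filled ground state up to a phase**: for `G` connected and
bipartite with `|A| = |B|`, `t ≠ 0`, `U > 0`, every half-filled ground state `ψ` of
`hamiltonian G t U` satisfies `conj ψ = c ψ` for some `c ∈ ℂ` (the Hamiltonian is real and the
ground state is unique, `LiebHalfFilled.finrank_groundSector_eq_one`).
[cite: LiebLossMccann1993, proof of Theorem (real case)] [cite: LiebPRL1989, Theorem 2] -/
theorem exists_star_eq_smul_of_groundState (hG : G.Connected) (A : Finset Λ)
    (hA : ∀ x y : Λ, G.Adj x y → (x ∈ A ↔ y ∉ A)) (hcard : Aᶜ.card = A.card)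
    {t U : ℝ} (ht : t ≠ 0) (hU : 0 < U) {ψ : Fock (Orb Λ)} (hN : IsNParticle (Fintype.card Λ) ψ)
    (hHψ : hamiltonian G t U *ᵥ ψ = ((groundEnergyAt G t U (Fintype.card Λ) : ℝ) : ℂ) • ψ) :
    ∃ c : ℂ, star ψ = c • ψ := by
  classical
  by_cases hψ0 : ψ = 0
  · exact ⟨0, by rw [hψ0, star_zero, smul_zero]⟩
  have hsN : IsNParticle (Fintype.card Λ) (star ψ) := fun s hs => by
    rw [Pi.star_apply, hN s hs, star_zero]
  have hsH : hamiltonian G t U *ᵥ star ψ =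
      ((groundEnergyAt G t U (Fintype.card Λ) : ℝ) : ℂ) • star ψ := by
    rw [← star_hamiltonian_mulVec G t U ψ, hHψ, star_smul, Complex.star_def, Complex.conj_ofReal]
  have hmem := (LiebHalfFilled.mem_groundSector_iff G t U _ ψ).2 ⟨hN, hHψ⟩
  have hsmem := (LiebHalfFilled.mem_groundSector_iff G t U _ (star ψ)).2 ⟨hsN, hsH⟩
  set V := (hamiltonian G t U).sectorGroundSpace (nParticleSubmodule (ι := Orb Λ) (Fintype.card Λ))
  have hv0 : (⟨ψ, hmem⟩ : V) ≠ 0 := fun h => hψ0 (congrArg Subtype.val h)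
  obtain ⟨c, hc⟩ := (finrank_eq_one_iff_of_nonzero' (⟨ψ, hmem⟩ : V) hv0).1
    (LiebHalfFilled.finrank_groundSector_eq_one hG A hA hcard ht hU).1 ⟨star ψ, hsmem⟩
  exact ⟨c, by simpa using (congrArg Subtype.val hc).symm⟩

/-- **Real observables have real expectations in the half-filled ground state**: if `Xᴴ = Xᵀ`
(a real matrix in the occupation basis) then `conj ⟨ψ, X ψ⟩ = ⟨ψ, X ψ⟩`.
[cite: LiebLossMccann1993, proof of Theorem (real case)] [cite: LiebPRL1989, Theorem 2] -/
theorem star_expect_eq_of_groundState (hG : G.Connected) (A : Finset Λ)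
    (hA : ∀ x y : Λ, G.Adj x y → (x ∈ A ↔ y ∉ A)) (hcard : Aᶜ.card = A.card)
    {t U : ℝ} (ht : t ≠ 0) (hU : 0 < U) {ψ : Fock (Orb Λ)} (hN : IsNParticle (Fintype.card Λ) ψ)
    (hHψ : hamiltonian G t U *ᵥ ψ = ((groundEnergyAt G t U (Fintype.card Λ) : ℝ) : ℂ) • ψ)
    {X : Matrix (Finset (Orb Λ)) (Finset (Orb Λ)) ℂ} (hX : Xᴴ = Xᵀ) :
    star (expect X ψ) = expect X ψ := by
  obtain ⟨c, hc⟩ := exists_star_eq_smul_of_groundState hG A hA hcard ht hU hN hHψ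
  unfold expect
  rw [← star_dotProduct (X *ᵥ ψ) ψ, star_mulVec_of_conjTranspose_eq_transpose hX, hc, mulVec_smul,
    smul_dotProduct, smul_dotProduct, dotProduct_comm (X *ᵥ ψ) ψ]

/-! ### §3 (W) Hole–particle symmetry of the unique half-filled ground state -/

/-- **The hole–particle transformation fixes the half-filled ground state up to a phase**: with
`P = particleHole (ε ∘ site)` for a bipartite sign `ε` (`c_{xσ} ↦ ε_x c†_{xσ}`), `Pᴴ ψ = c ψ` for
some `c ∈ ℂ` (`P H Pᴴ = H - U N̂ + U|Λ|` acts as `H` on the half-filled sector, and the ground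
state is unique). MacLachlan's map `W` of Lieb–Loss–McCann (1993), eq. (7).
[cite: LiebLossMccann1993, eq. (7) and proof of Theorem] [cite: LiebPRL1989, Theorem 2]
[cite: Tasaki2020, §9.3.3] -/
theorem exists_particleHole_conjTranspose_mulVec_eq_smul (hG : G.Connected) (A : Finset Λ)
    (hA : ∀ x y : Λ, G.Adj x y → (x ∈ A ↔ y ∉ A)) (hcard : Aᶜ.card = A.card)
    {t U : ℝ} (ht : t ≠ 0) (hU : 0 < U) (ε : Λ → ℤˣ) (hε : ∀ x y : Λ, G.Adj x y → ε x = -ε y)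
    {ψ : Fock (Orb Λ)} (hN : IsNParticle (Fintype.card Λ) ψ)
    (hHψ : hamiltonian G t U *ᵥ ψ = ((groundEnergyAt G t U (Fintype.card Λ) : ℝ) : ℂ) • ψ) :
    ∃ c : ℂ, (particleHole (fun i : Orb Λ => ((ε (ofLex i).1 : ℤ) : ℂ)))ᴴ *ᵥ ψ = c • ψ := by
  classical
  by_cases hψ0 : ψ = 0
  · exact ⟨0, by rw [hψ0, mulVec_zero, smul_zero]⟩
  set ε' : Orb Λ → ℂ := fun i => ((ε (ofLex i).1 : ℤ) : ℂ) with hε'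
  have hn : ∀ i, ‖ε' i‖ = 1 := fun i => norm_intCast_units _
  set P := particleHole ε' with hP
  have hPP : Pᴴ * P = 1 := particleHole_conjTranspose_mul ε' hn
  have hconj : P * hamiltonian G t U * Pᴴ =
      hamiltonian G t U - (U : ℂ) • totalNumber + ((U * Fintype.card Λ : ℝ) : ℂ) • 1 :=
    hamiltonian_particleHole_bipartite_holds G t U ε hε
  -- `Pᴴ ψ` is a half-filled vector …
  have hφN : IsNParticle (Fintype.card Λ) (Pᴴ *ᵥ ψ) := by
    intro s hs
    rw [particleHole_conjTranspose_mulVec_apply]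
    have hc : sᶜ.card ≠ Fintype.card Λ := by
      rw [Finset.card_compl, card_orb]
      have := s.card_le_univ
      rw [card_orb] at this
      omega
    rw [hN _ hc, mul_zero]
  -- … and an eigenvector of `H` with the ground-state energy
  have hHP : hamiltonian G t U * Pᴴ =
      Pᴴ * (hamiltonian G t U - (U : ℂ) • totalNumber + ((U * Fintype.card Λ : ℝ) : ℂ) • 1) := by
    rw [← hconj, ← Matrix.mul_assoc, ← Matrix.mul_assoc, hPP, Matrix.one_mul]
  have hφH : hamiltonian G t U *ᵥ (Pᴴ *ᵥ ψ) =
      ((groundEnergyAt G t U (Fintype.card Λ) : ℝ) : ℂ) • (Pᴴ *ᵥ ψ) := by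
    rw [mulVec_mulVec, hHP, ← mulVec_mulVec, add_mulVec, sub_mulVec, smul_mulVec, smul_mulVec,
      one_mulVec, hHψ, totalNumber_mulVec_of_isNParticle hN, smul_smul, ← mulVec_smul]
    congr 1
    have hc : ((U * Fintype.card Λ : ℝ) : ℂ) = (U : ℂ) * (Fintype.card Λ : ℂ) := by push_cast; ring
    rw [hc, sub_add_cancel]
  have hmem := (LiebHalfFilled.mem_groundSector_iff G t U _ ψ).2 ⟨hN, hHψ⟩
  have hPmem := (LiebHalfFilled.mem_groundSector_iff G t U _ (Pᴴ *ᵥ ψ)).2 ⟨hφN, hφH⟩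
  set V := (hamiltonian G t U).sectorGroundSpace (nParticleSubmodule (ι := Orb Λ) (Fintype.card Λ))
  have hv0 : (⟨ψ, hmem⟩ : V) ≠ 0 := fun h => hψ0 (congrArg Subtype.val h)
  obtain ⟨c, hc⟩ := (finrank_eq_one_iff_of_nonzero' (⟨ψ, hmem⟩ : V) hv0).1
    (LiebHalfFilled.finrank_groundSector_eq_one hG A hA hcard ht hU).1 ⟨Pᴴ *ᵥ ψ, hPmem⟩
  exact ⟨c, by simpa using (congrArg Subtype.val hc).symm⟩

/-- **Hole–particle invariance of ground-state expectations**: `⟨ψ, P X Pᴴ ψ⟩ = ⟨ψ, X ψ⟩` for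
every operator `X`, `P` the full particle–hole transformation with bipartite phases. The `β → ∞`
canonical case of `Tr[W X W e^{-βH}] = Tr[X e^{-βH}]` in Lieb–Loss–McCann (1993), proof of the
Theorem. [cite: LiebLossMccann1993, proof of Theorem] [cite: LiebPRL1989, Theorem 2] -/
theorem expect_particleHole_conj_eq_of_groundState (hG : G.Connected) (A : Finset Λ)
    (hA : ∀ x y : Λ, G.Adj x y → (x ∈ A ↔ y ∉ A)) (hcard : Aᶜ.card = A.card)
    {t U : ℝ} (ht : t ≠ 0) (hU : 0 < U) (ε : Λ → ℤˣ) (hε : ∀ x y : Λ, G.Adj x y → ε x = -ε y)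
    {ψ : Fock (Orb Λ)} (hN : IsNParticle (Fintype.card Λ) ψ)
    (hHψ : hamiltonian G t U *ᵥ ψ = ((groundEnergyAt G t U (Fintype.card Λ) : ℝ) : ℂ) • ψ)
    (X : Matrix (Finset (Orb Λ)) (Finset (Orb Λ)) ℂ) :
    expect (particleHole (fun i : Orb Λ => ((ε (ofLex i).1 : ℤ) : ℂ)) * X *
        (particleHole (fun i : Orb Λ => ((ε (ofLex i).1 : ℤ) : ℂ)))ᴴ) ψ = expect X ψ := by
  classical
  by_cases hψ0 : ψ = 0
  · simp [expect, hψ0]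
  obtain ⟨c, hc⟩ :=
    exists_particleHole_conjTranspose_mulVec_eq_smul hG A hA hcard ht hU ε hε hN hHψ
  set ε' : Orb Λ → ℂ := fun i => ((ε (ofLex i).1 : ℤ) : ℂ) with hε'
  have hn : ∀ i, ‖ε' i‖ = 1 := fun i => norm_intCast_units _
  set P := particleHole ε' with hP
  have hunit : star (Pᴴ *ᵥ ψ) ⬝ᵥ (Pᴴ *ᵥ ψ) = star ψ ⬝ᵥ ψ := by
    rw [star_mulVec, conjTranspose_conjTranspose, ← dotProduct_mulVec, mulVec_mulVec,
      particleHole_mul_conjTranspose ε' hn, one_mulVec]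
  have hcc : star c * c = 1 := by
    rw [hc, star_smul, smul_dotProduct, dotProduct_smul, smul_smul, smul_eq_mul] at hunit
    have hne : star ψ ⬝ᵥ ψ ≠ 0 := fun h => hψ0 (dotProduct_star_self_eq_zero.1 h)
    exact mul_right_cancel₀ hne (by rw [hunit, one_mul])
  have hvec : star ψ ᵥ* P = star (Pᴴ *ᵥ ψ) := by rw [star_mulVec, conjTranspose_conjTranspose]
  unfold expect
  rw [← mulVec_mulVec, ← mulVec_mulVec, dotProduct_mulVec (star ψ) P, hvec, hc, star_smul,
    mulVec_smul, smul_dotProduct, dotProduct_smul, smul_smul, hcc, one_smul]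

/-- **The hole–particle relation for the one-body density matrix** of the half-filled ground state:
for all orbitals `a = (x,σ)`, `b = (y,τ)`,
`⟨ψ, c†_a c_b ψ⟩ = ε_x ε_y (δ_{ab} ‖ψ‖² - ⟨ψ, c†_b c_a ψ⟩)` — Lieb–Loss–McCann's
`ρ(x,y) = δ_{xy} - ρ(y,x)` for `x, y` on the same sublattice.
[cite: LiebLossMccann1993, proof of Theorem] [cite: LiebPRL1989, Theorem 2] -/
theorem expect_creation_mul_annihilation_particleHole (hG : G.Connected) (A : Finset Λ)
    (hA : ∀ x y : Λ, G.Adj x y → (x ∈ A ↔ y ∉ A)) (hcard : Aᶜ.card = A.card)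
    {t U : ℝ} (ht : t ≠ 0) (hU : 0 < U) (ε : Λ → ℤˣ) (hε : ∀ x y : Λ, G.Adj x y → ε x = -ε y)
    {ψ : Fock (Orb Λ)} (hN : IsNParticle (Fintype.card Λ) ψ)
    (hHψ : hamiltonian G t U *ᵥ ψ = ((groundEnergyAt G t U (Fintype.card Λ) : ℝ) : ℂ) • ψ)
    (a b : Orb Λ) :
    expect (creation a * annihilation b) ψ =
      ((ε (ofLex a).1 : ℤ) : ℂ) * ((ε (ofLex b).1 : ℤ) : ℂ) *
        ((if a = b then star ψ ⬝ᵥ ψ else 0) - expect (creation b * annihilation a) ψ) := by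
  classical
  have hX := expect_particleHole_conj_eq_of_groundState hG A hA hcard ht hU ε hε hN hHψ
    (creation a * annihilation b)
  set ε' : Orb Λ → ℂ := fun i => ((ε (ofLex i).1 : ℤ) : ℂ) with hε'
  have hn : ∀ i, ‖ε' i‖ = 1 := fun i => norm_intCast_units _
  set P := particleHole ε' with hP
  have hPP : Pᴴ * P = 1 := particleHole_conjTranspose_mul ε' hn
  have hsplit : P * (creation a * annihilation b) * Pᴴ =
      (P * creation a * Pᴴ) * (P * annihilation b * Pᴴ) := by
    simp only [Matrix.mul_assoc]
    rw [← Matrix.mul_assoc Pᴴ P, hPP, Matrix.one_mul]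
  have hcar : annihilation a * creation b = (if a = b then 1 else 0) - creation b * annihilation a :=
    eq_sub_of_add_eq (annihilation_mul_creation_add_creation_mul_annihilation_holds a b)
  have hstar : star (ε' a) = ε' a := by
    simp only [hε']
    exact star_intCast_units _
  rw [← hX, hsplit, particleHole_mul_creation_mul_conjTranspose ε' hn a,
    particleHole_mul_annihilation_mul_conjTranspose_holds ε' hn b, Matrix.smul_mul,
    Matrix.mul_smul, smul_smul, hcar, hstar, expect_smul₁, expect_sub₁, expect_ite_one_zero]

/-! ### §4 The theorem: reality, symmetry, uniform density, and eq. (6) -/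

/-- **The one-body density matrix of the half-filled ground state is real**:
`conj ⟨ψ, c†_a c_b ψ⟩ = ⟨ψ, c†_a c_b ψ⟩` for all orbitals `a, b`.
[cite: LiebLossMccann1993, Theorem (proof, real case)] [cite: LiebPRL1989, Theorem 2] -/
theorem star_expect_creation_mul_annihilation_of_groundState (hG : G.Connected) (A : Finset Λ)
    (hA : ∀ x y : Λ, G.Adj x y → (x ∈ A ↔ y ∉ A)) (hcard : Aᶜ.card = A.card)
    {t U : ℝ} (ht : t ≠ 0) (hU : 0 < U) {ψ : Fock (Orb Λ)} (hN : IsNParticle (Fintype.card Λ) ψ)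
    (hHψ : hamiltonian G t U *ᵥ ψ = ((groundEnergyAt G t U (Fintype.card Λ) : ℝ) : ℂ) • ψ)
    (a b : Orb Λ) :
    star (expect (creation a * annihilation b) ψ) = expect (creation a * annihilation b) ψ :=
  star_expect_eq_of_groundState hG A hA hcard ht hU hN hHψ
    (conjTranspose_mul_eq_transpose (conjTranspose_creation_eq_transpose a)
      (conjTranspose_annihilation_eq_transpose b))

/-- **The one-body density matrix of the half-filled ground state is symmetric**:
`⟨ψ, c†_a c_b ψ⟩ = ⟨ψ, c†_b c_a ψ⟩` (Hermitian and real).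
[cite: LiebLossMccann1993, Theorem (proof)] [cite: LiebPRL1989, Theorem 2] -/
theorem expect_creation_mul_annihilation_comm_of_groundState (hG : G.Connected) (A : Finset Λ)
    (hA : ∀ x y : Λ, G.Adj x y → (x ∈ A ↔ y ∉ A)) (hcard : Aᶜ.card = A.card)
    {t U : ℝ} (ht : t ≠ 0) (hU : 0 < U) {ψ : Fock (Orb Λ)} (hN : IsNParticle (Fintype.card Λ) ψ)
    (hHψ : hamiltonian G t U *ᵥ ψ = ((groundEnergyAt G t U (Fintype.card Λ) : ℝ) : ℂ) • ψ)
    (a b : Orb Λ) :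
    expect (creation a * annihilation b) ψ = expect (creation b * annihilation a) ψ := by
  rw [← star_expect_creation_mul_annihilation_of_groundState hG A hA hcard ht hU hN hHψ a b,
    ← expect_conjTranspose₁, conjTranspose_mul, annihilation_conjTranspose, creation_conjTranspose]

/-- **Lieb–Loss–McCann eq. (6) for the ground state**: for distinct orbitals `a = (x,σ) ≠ b = (y,τ)`
with `x, y` on the same sublattice (`ε_x = ε_y`), `⟨ψ, c†_a c_b ψ⟩ = 0` — the one-body density
matrix of the half-filled repulsive ground state connects only opposite sublattices (for every
`U > 0`; in particular `⟨c†_{xσ} c_{yσ}⟩ = 0` for `x ≠ y` of the same colour and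
`⟨c†_{x↑} c_{x↓}⟩ = 0`). [cite: LiebLossMccann1993, Theorem eq. (6)] [cite: LiebPRL1989, Theorem 2] -/
theorem expect_creation_mul_annihilation_eq_zero_of_groundState (hG : G.Connected) (A : Finset Λ)
    (hA : ∀ x y : Λ, G.Adj x y → (x ∈ A ↔ y ∉ A)) (hcard : Aᶜ.card = A.card)
    {t U : ℝ} (ht : t ≠ 0) (hU : 0 < U) (ε : Λ → ℤˣ) (hε : ∀ x y : Λ, G.Adj x y → ε x = -ε y)
    {ψ : Fock (Orb Λ)} (hN : IsNParticle (Fintype.card Λ) ψ)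
    (hHψ : hamiltonian G t U *ᵥ ψ = ((groundEnergyAt G t U (Fintype.card Λ) : ℝ) : ℂ) • ψ)
    {a b : Orb Λ} (hab : a ≠ b) (hεab : ε (ofLex a).1 = ε (ofLex b).1) :
    expect (creation a * annihilation b) ψ = 0 := by
  have h1 := expect_creation_mul_annihilation_particleHole hG A hA hcard ht hU ε hε hN hHψ a b
  rw [if_neg hab, zero_sub, hεab, intCast_units_mul_self, one_mul,
    ← expect_creation_mul_annihilation_comm_of_groundState hG A hA hcard ht hU hN hHψ a b] at h1
  exact add_self_eq_zero.1 (by linear_combination h1)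

/-- **Lieb–Loss–McCann eq. (5) for the ground state** (uniform density, their proof):
`⟨ψ, c†_a c_a ψ⟩ = ‖ψ‖²/2` for every orbital `a`. (Another proof, via the pseudospin, is
`expect_numberOp_eq_half_of_groundState` in `HubbardPseudospinIsotropy`.)
[cite: LiebLossMccann1993, Theorem eq. (5)] [cite: LiebPRL1989, Theorem 2] -/
theorem expect_numberAt_eq_half_of_groundState' (hG : G.Connected) (A : Finset Λ)
    (hA : ∀ x y : Λ, G.Adj x y → (x ∈ A ↔ y ∉ A)) (hcard : Aᶜ.card = A.card)
    {t U : ℝ} (ht : t ≠ 0) (hU : 0 < U) (ε : Λ → ℤˣ) (hε : ∀ x y : Λ, G.Adj x y → ε x = -ε y)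
    {ψ : Fock (Orb Λ)} (hN : IsNParticle (Fintype.card Λ) ψ)
    (hHψ : hamiltonian G t U *ᵥ ψ = ((groundEnergyAt G t U (Fintype.card Λ) : ℝ) : ℂ) • ψ)
    (a : Orb Λ) :
    expect (creation a * annihilation a) ψ = (1 / 2 : ℂ) * (star ψ ⬝ᵥ ψ) := by
  have h1 := expect_creation_mul_annihilation_particleHole hG A hA hcard ht hU ε hε hN hHψ a a
  rw [if_pos rfl, intCast_units_mul_self, one_mul] at h1
  linear_combination h1 / 2

/-- `IsGroundState` form of eq. (6). [cite: LiebLossMccann1993, Theorem eq. (6)]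
[cite: LiebPRL1989, Theorem 2] -/
theorem expect_creation_mul_annihilation_eq_zero_of_isGroundState (hG : G.Connected) (A : Finset Λ)
    (hA : ∀ x y : Λ, G.Adj x y → (x ∈ A ↔ y ∉ A)) (hcard : Aᶜ.card = A.card)
    {t U : ℝ} (ht : t ≠ 0) (hU : 0 < U) (ε : Λ → ℤˣ) (hε : ∀ x y : Λ, G.Adj x y → ε x = -ε y)
    {ψ : Fock (Orb Λ)} (hψ : IsGroundState (hamiltonian G t U) (Fintype.card Λ) ψ)
    {a b : Orb Λ} (hab : a ≠ b) (hεab : ε (ofLex a).1 = ε (ofLex b).1) :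
    expect (creation a * annihilation b) ψ = 0 :=
  expect_creation_mul_annihilation_eq_zero_of_groundState hG A hA hcard ht hU ε hε hψ.1 hψ.2.2 hab
    hεab

end Graph

/-! ### §5 The even square torus `(ℤ/Lℤ)²` with `ε = torusStagger` -/

section Torus

variable {L : ℕ} [NeZero L]

omit [NeZero L] in
/-- `|(ℤ/Lℤ)²| = L²` for the fermion torus. [folklore] -/
private theorem card_fermionTorus_two : Fintype.card (FermionTorus 2 L) = L ^ 2 := by
  simp only [FermionTorus, Fintype.card_lex, Fintype.card_fun, Fintype.card_fin]

omit [NeZero L] in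
/-- `ε_x ε_{x+r} = ε_r` on a torus of even side. [folklore] -/
private theorem torusStagger_mul_torusStagger_add' {d : ℕ} (hL : Even L) (x r : FermionTorus d L) :
    torusStagger x * torusStagger (x + r) = torusStagger r := by
  have h2 : (2 : ℕ) ∣ L := even_iff_two_dvd.mp hL
  have hmod : (∑ i, (ofLex (x + r) i : ℕ)) % 2 =
      (∑ i, (ofLex x i : ℕ) + ∑ i, (ofLex r i : ℕ)) % 2 := by
    calc (∑ i, (ofLex (x + r) i : ℕ)) % 2
        = (∑ i, ((ofLex x i : ℕ) + (ofLex r i : ℕ)) % L) % 2 :=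
          congrArg (· % 2) (Finset.sum_congr rfl fun i _ => Fin.val_add _ _)
      _ = (∑ i, ((ofLex x i : ℕ) + (ofLex r i : ℕ)) % L % 2) % 2 := Finset.sum_nat_mod _ _ _
      _ = (∑ i, ((ofLex x i : ℕ) + (ofLex r i : ℕ)) % 2) % 2 :=
          congrArg (· % 2) (Finset.sum_congr rfl fun i _ => Nat.mod_mod_of_dvd _ h2)
      _ = (∑ i, ((ofLex x i : ℕ) + (ofLex r i : ℕ))) % 2 := (Finset.sum_nat_mod _ _ _).symm
      _ = (∑ i, (ofLex x i : ℕ) + ∑ i, (ofLex r i : ℕ)) % 2 := by rw [Finset.sum_add_distrib]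
  have hkey : (∑ i, (ofLex x i : ℕ) + ∑ i, (ofLex (x + r) i : ℕ)) % 2 =
      (∑ i, (ofLex r i : ℕ)) % 2 := by
    omega
  have hpow : ∀ (u : ℤˣ) (n : ℕ), u ^ n = u ^ (n % 2) := fun u n => Int.units_pow_eq_pow_mod_two u n
  rw [torusStagger_apply, torusStagger_apply, torusStagger_apply, ← uzpow_add, hpow, hkey, ← hpow]

omit [NeZero L] in
/-- On a torus of even side, `ε_r = 1` implies `ε_{x+r} = ε_x`. [folklore] -/
private theorem torusStagger_add_eq_of_eq_one {d : ℕ} (hL : Even L) (x : FermionTorus d L)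
    {r : FermionTorus d L} (hr : torusStagger r = 1) : torusStagger (x + r) = torusStagger x := by
  have h := torusStagger_mul_torusStagger_add' hL x r
  rw [hr] at h
  calc torusStagger (x + r) = torusStagger x * (torusStagger x * torusStagger (x + r)) := by
        rw [← mul_assoc, Int.units_mul_self, one_mul]
    _ = torusStagger x := by rw [h, mul_one]

/-- **Eq. (6) on the even square torus**: for every half-filled ground state `ψ` of
`hamiltonian (fermionTorusGraph 2 L) t U` (`L` even, `t ≠ 0`, `U > 0`) and orbitals
`(x,σ) ≠ (y,τ)` with `x, y` of the same parity (`ε_x = ε_y`, `ε = (-1)^{x₁+x₂}`),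
`⟨ψ, c†_{xσ} c_{yτ} ψ⟩ = 0`. [cite: LiebLossMccann1993, Theorem eq. (6)]
[cite: LiebPRL1989, Theorem 2] -/
theorem hubbardTorus_expect_creation_mul_annihilation_eq_zero (hL : Even L) {t U : ℝ} (ht : t ≠ 0)
    (hU : 0 < U) {ψ : Fock (Orb (FermionTorus 2 L))}
    (hψ : IsGroundState (hamiltonian (fermionTorusGraph 2 L) t U) (L ^ 2) ψ)
    {x y : FermionTorus 2 L} {σ τ : Fin 2} (hne : orb x σ ≠ orb y τ)
    (hxy : torusStagger x = torusStagger y) :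
    expect (creation (orb x σ) * annihilation (orb y τ)) ψ = 0 := by
  obtain ⟨hG, hA, h2, -⟩ := LiebHalfFilled.hubbardTorus_lieb_hypotheses (L := L) hL
  have hcard := LiebHalfFilled.compl_card_eq_card_of_two_mul h2
  have hε : ∀ x y : FermionTorus 2 L, (fermionTorusGraph 2 L).Adj x y →
      torusStagger x = -torusStagger y := fun x y h => torusStagger_eq_neg_of_adj_holds hL h
  obtain ⟨hN, -, hHψ⟩ := hψ
  rw [← card_fermionTorus_two] at hN hHψ
  exact expect_creation_mul_annihilation_eq_zero_of_groundState hG _ hA hcard ht hU _ hε hN hHψ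
    hne hxy

/-- **Translate form of eq. (6) on the even square torus**: for every displacement `r ≠ 0` of even
parity (`ε_r = +1`, i.e. `r₁ + r₂` even on representatives) and every spin,
`⟨ψ, c†_{xσ} c_{x+r,σ} ψ⟩ = 0`. [cite: LiebLossMccann1993, Theorem eq. (6)]
[cite: LiebPRL1989, Theorem 2] -/
theorem hubbardTorus_expect_creation_mul_annihilation_translate_eq_zero (hL : Even L) {t U : ℝ}
    (ht : t ≠ 0) (hU : 0 < U) {ψ : Fock (Orb (FermionTorus 2 L))}
    (hψ : IsGroundState (hamiltonian (fermionTorusGraph 2 L) t U) (L ^ 2) ψ)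
    {r : FermionTorus 2 L} (hr0 : r ≠ 0) (hr : torusStagger r = 1) (x : FermionTorus 2 L)
    (σ : Fin 2) :
    expect (creation (orb x σ) * annihilation (orb (x + r) σ)) ψ = 0 := by
  refine hubbardTorus_expect_creation_mul_annihilation_eq_zero hL ht hU hψ ?_
    (torusStagger_add_eq_of_eq_one hL x hr).symm
  intro h
  have h' : x = x + r := by simpa [orb] using congrArg (fun i : Orb (FermionTorus 2 L) => (ofLex i).1) h
  exact hr0 (by simpa using h'.symm)

/-- **The one-body density matrix of the torus ground state is real and symmetric**:
`conj ⟨c†_a c_b⟩ = ⟨c†_a c_b⟩ = ⟨c†_b c_a⟩`. [cite: LiebLossMccann1993, Theorem (proof)]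
[cite: LiebPRL1989, Theorem 2] -/
theorem hubbardTorus_expect_creation_mul_annihilation_real_symm (hL : Even L) {t U : ℝ}
    (ht : t ≠ 0) (hU : 0 < U) {ψ : Fock (Orb (FermionTorus 2 L))}
    (hψ : IsGroundState (hamiltonian (fermionTorusGraph 2 L) t U) (L ^ 2) ψ)
    (a b : Orb (FermionTorus 2 L)) :
    star (expect (creation a * annihilation b) ψ) = expect (creation a * annihilation b) ψ ∧
      expect (creation a * annihilation b) ψ = expect (creation b * annihilation a) ψ := by
  obtain ⟨hG, hA, h2, -⟩ := LiebHalfFilled.hubbardTorus_lieb_hypotheses (L := L) hL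
  have hcard := LiebHalfFilled.compl_card_eq_card_of_two_mul h2
  obtain ⟨hN, -, hHψ⟩ := hψ
  rw [← card_fermionTorus_two] at hN hHψ
  exact ⟨star_expect_creation_mul_annihilation_of_groundState hG _ hA hcard ht hU hN hHψ a b,
    expect_creation_mul_annihilation_comm_of_groundState hG _ hA hcard ht hU hN hHψ a b⟩

/-- **Uniform density on the torus, eq. (5)** (LLM's proof): `⟨ψ, c†_{xσ} c_{xσ} ψ⟩ = ‖ψ‖²/2`.
[cite: LiebLossMccann1993, Theorem eq. (5)] [cite: LiebPRL1989, Theorem 2] -/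
theorem hubbardTorus_expect_numberAt_eq_half' (hL : Even L) {t U : ℝ} (ht : t ≠ 0) (hU : 0 < U)
    {ψ : Fock (Orb (FermionTorus 2 L))}
    (hψ : IsGroundState (hamiltonian (fermionTorusGraph 2 L) t U) (L ^ 2) ψ)
    (x : FermionTorus 2 L) (σ : Fin 2) :
    expect (creation (orb x σ) * annihilation (orb x σ)) ψ = (1 / 2 : ℂ) * (star ψ ⬝ᵥ ψ) := by
  obtain ⟨hG, hA, h2, -⟩ := LiebHalfFilled.hubbardTorus_lieb_hypotheses (L := L) hL
  have hcard := LiebHalfFilled.compl_card_eq_card_of_two_mul h2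
  have hε : ∀ x y : FermionTorus 2 L, (fermionTorusGraph 2 L).Adj x y →
      torusStagger x = -torusStagger y := fun x y h => torusStagger_eq_neg_of_adj_holds hL h
  obtain ⟨hN, -, hHψ⟩ := hψ
  rw [← card_fermionTorus_two] at hN hHψ
  exact expect_numberAt_eq_half_of_groundState' hG _ hA hcard ht hU _ hε hN hHψ (orb x σ)

/-- **Even-part sum rule for the one-body density matrix on the torus** (eqs. (5)–(6) together):
for every test function `f` on displacements and every spin,
`Σ_r f(r) (1 + ε_r) Σ_x ⟨ψ, c†_{xσ} c_{x+r,σ} ψ⟩ = L² f(0) ‖ψ‖²` — only `r = 0` contributes to the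
even-parity part. With `f(r) = e^{-ik·r}/L²` this reads `n_σ(k) + n_σ(k + (π,π)) = ‖ψ‖²` for the
momentum distribution `n_σ(k) = L⁻² Σ_{x,y} e^{ik·(x-y)} ⟨c†_{xσ} c_{yσ}⟩`.
[cite: LiebLossMccann1993, Theorem eqs. (5)-(6)] [cite: LiebPRL1989, Theorem 2] -/
theorem hubbardTorus_sum_even_translate_oneBody_eq (hL : Even L) {t U : ℝ} (ht : t ≠ 0)
    (hU : 0 < U) {ψ : Fock (Orb (FermionTorus 2 L))}
    (hψ : IsGroundState (hamiltonian (fermionTorusGraph 2 L) t U) (L ^ 2) ψ) (σ : Fin 2)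
    (f : FermionTorus 2 L → ℂ) :
    ∑ r : FermionTorus 2 L, f r * (1 + ((torusStagger r : ℤ) : ℂ)) *
        ∑ x : FermionTorus 2 L, expect (creation (orb x σ) * annihilation (orb (x + r) σ)) ψ =
      ((L ^ 2 : ℕ) : ℂ) * f 0 * (star ψ ⬝ᵥ ψ) := by
  rw [Finset.sum_eq_single (0 : FermionTorus 2 L)]
  · have h0 : ∀ x : FermionTorus 2 L,
        expect (creation (orb x σ) * annihilation (orb (x + 0) σ)) ψ = (1 / 2 : ℂ) * (star ψ ⬝ᵥ ψ) :=
      fun x => by rw [add_zero]; exact hubbardTorus_expect_numberAt_eq_half' hL ht hU hψ x σ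
    have hε0 : ((torusStagger (0 : FermionTorus 2 L) : ℤ) : ℂ) = 1 := by
      have h := torusStagger_mul_torusStagger_add' hL (0 : FermionTorus 2 L) 0
      rw [add_zero, Int.units_mul_self] at h
      rw [← h, Units.val_one, Int.cast_one]
    rw [Finset.sum_congr rfl fun x _ => h0 x, Finset.sum_const, Finset.card_univ,
      card_fermionTorus_two, hε0, nsmul_eq_mul]
    ring
  · intro r _ hr0
    rcases Int.units_eq_one_or (torusStagger r) with h | h
    · rw [Finset.sum_congr rfl fun x _ =>
        hubbardTorus_expect_creation_mul_annihilation_translate_eq_zero hL ht hU hψ hr0 h x σ,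
        Finset.sum_const_zero, mul_zero]
    · rw [h]
      push_cast
      ring
  · intro h
    exact absurd (Finset.mem_univ _) h

end Torus

end Literature.MathematicalPhysics.QuantumLattice
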